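import Summits.BirchSwinnertonDyer.BirchSwinnertonDyer.Theorems.TwoAdicConverseLambdaHalfTowerKH65797a
import Summits.BirchSwinnertonDyer.BirchSwinnertonDyer.Theorems.TwoAdicConverseLambdaHalfTowerKH251493a
import Summits.BirchSwinnertonDyer.BirchSwinnertonDyer.Theorems.TwoAdicConverseLambdaHalfTowerKH300219c
import Summits.BirchSwinnertonDyer.BirchSwinnertonDyer.Theorems.TwoAdicConverseLambdaHalfTowerKH375411g
import Summits.BirchSwinnertonDyer.BirchSwinnertonDyer.Theorems.TwoAdicConverseLambdaHalfTowerKH445851o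
import Summits.BirchSwinnertonDyer.BirchSwinnertonDyer.Theorems.TwoAdicConverseLambdaHalfTowerKH488965b
import Summits.BirchSwinnertonDyer.BirchSwinnertonDyer.Theorems.TwoAdicConverseLambdaHalfTowerKH407305e
import Summits.BirchSwinnertonDyer.BirchSwinnertonDyer.Theorems.TwoAdicConverseLambdaHalfTowerKH288855s
import Summits.BirchSwinnertonDyer.Rank1Residual.X5.KatoOrdTwoTowerGapIff
import HarnessLib

/-!
# Route `TwoAdicConverse` (rung S3), crux `OrdLambdaHalfAtTwo` (item 19556): the GREENBERG-μ DOOR of the `λ`-half, KATO-FREE, and the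
# 8 «KH» residue classes re-keyed on it — item 19556 AT each of them is EXACTLY one instance of Greenberg's «`Sel_E(ℚ_∞)₂` cotorsion, `μ_E = 0`»

Cell `bsd-2adic` (run/shared/lean/pub/bsd-2adic/), seat `bsd-2adic-conv-1x` (WIDTH-LEVER second lane on item 19556, GEN 5). THEOREMS ONLY.

WHAT. After GEN 5's α-go landing the tree-derived S3 census (`HOME/conv1x/tables/S3-CENSUS-611-conv1x-g5.tsv`) reads KATO-FREE 585 / 611,
NO ROW 17, and BY-NAME 9 = 222339b (ORD-RED) + the EIGHT `E[2]`-IRREDUCIBLE «KH» classes 65797a 251493a 300219c 375411g 445851o 488965b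
(λ_an = 9) and 407305e 288855s (λ_an = 10): own layer-`3` count `2^{λ_an} ≤ #Sel_{2^∞}(E/ℚ_3)[2]` certified, but the count SATURATES
(`e = (2,3,5,9)`-type), so no tower gap exists below layer `4` (ord-2 MEMO-6) and their only S3 rows (GEN 3, `…TowerKH<cls>.lean`) display
the KATO HALF AT THE CURVE BY NAME (`hK : MainConjectureLowerDivisibilityAtTwoOrd c<m>`, K4 item 19271) + Kato 17.4 (1)(2)@2 `h17` + the
`μ_an`-certificate `hμan` — three inputs whose only use is to produce «`X(E/ℚ_∞)` torsion ∧ `μ = 0`». This file displays THAT statement itself: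
* §1 `lambdaHalfAtTwo_of_isTorsion_mu_eq_zero_of_layerSelmer_of_abbesUllmo` — PRINT {`hmod`, Greenberg 4.14@2 `h414`, Abbes–Ullmo `hAU`} +
  the RESEARCH binder `hμ : ∀ cyclotomic data, X torsion ∧ μ(X) = 0` (Greenberg LNM 1716 Conj. 1.11 AT the curve; for `E[2]` irreducible this is
  Greenberg's `μ = 0` conjecture instance) + CERT {`2^n ≤ #Sel_{2^∞}(E/ℚ_j)[2]`, `λ_an = n`} ⟹ `LambdaHalfAtTwo W`, by X5's
  `towerGapAtTwo_iff_isTorsion_and_mu_eq_zero` (the typed gap certificate IS that statement) and GEN 0's `lambdaHalfAtTwo_of_towerGap_of_layerSelmer_of_abbesUllmo`.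
  NO Kato 17.4, NO `μ_an`, NO item 19271, NO reserve token. (Logically: `hK ∧ hμan ∧ h17 ⟹ hμ` is ord's p533609; `hμ ⟹ hK` is X5's
  `mainConjectureLowerDivisibilityAtTwoOrd_of_towerGapAtTwo` — so modulo PRINT + CERT the two displays are equivalent; this one is binder-minimal.)
* §2 the eight rows `lambdaHalfAtTwo_<m>_muZero_L3`, kernel data (minimality, good ordinary at `2`, `E[2]` irreducible) from the GEN 3 KH files.

HONEST FRAMING. BY-NAME rows: each displays an OPEN research statement (Greenberg's conjecture at the curve); they do not make the classes
Kato-free and move no census count; what closes them Kato-free is a layer-`4` datum (gap `(3,4)`) at the class or at a congruent seed —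
COMPUTE-bound (ord-2 / tower-eng). Item 19556 stays OPEN at the `∀`-level; nothing booked; BSD is not proved by any of this.
PARTITION (D-0054): none — RANK axis (S3); companion formula cell X5@2 good-ord open `E[2]`-irreducible KH block (8 classes) × `p = 2` —
types-the-object-of; closes none; bears_on: S3 (19556), K4 (19271 at the same curves).

References: R. Greenberg, LNM 1716 (1999), §1 Conj. 1.11, §3 pp. 85–86, Prop. 4.14 [GreenbergLNM1716]; L. Washington, GTM 83, §13.2 [Washington1997];
A. Abbes, E. Ullmo, Compositio 103 (1996), Thm. A [AbbesUllmo1996]; R. Greenberg, V. Vatsal, Invent. Math. 142 (2000), p. 4 [GreenbergVatsal2000].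
-/

set_option linter.dupNamespace false
set_option autoImplicit false

noncomputable section

open scoped Classical MatrixGroups ModularForm
open CongruenceSubgroup WeierstrassCurve Literature.NumberTheory.EllipticCurves
  Literature.NumberTheory.EllipticCurves.ModularForms Literature.NumberTheory.EllipticCurves.Rank1Residual
  Literature.NumberTheory.EllipticCurves.Rank1Residual.Typed
  Literature.NumberTheory.EllipticCurves.Greenberg1999
  Summit.BirchSwinnertonDyer.BirchSwinnertonDyer.Theorems.Rank1ResidualX1Defs
  Summit.BirchSwinnertonDyer.Rank1Residual.X1.MuLambda Summit.BirchSwinnertonDyer.Rank1Residual.X1.ParitySqueeze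
  Summit.BirchSwinnertonDyer.Rank1Residual Summit.BirchSwinnertonDyer.Rank1Residual.X5
  Summit.BirchSwinnertonDyer.Rank1Residual.X5.O1

namespace Summit.BirchSwinnertonDyer.BirchSwinnertonDyer.Theorems.TwoAdicTwistConverse

/-! ## §1 The Greenberg-μ door: «X torsion ∧ μ = 0» displayed as such -/

section Door

variable (W : WeierstrassCurve ℚ) [W.IsElliptic] [W.IsGloballyMinimal]

/-- **GREENBERG-μ DOOR of the `λ`-half (KATO-FREE, binder-minimal) on the `E[2]`-irreducible good-ordinary block.** PRINT {modularity `hmod`,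
Greenberg Prop. 4.14@2 `h414`, Abbes–Ullmo Thm. A `hAU`}; kernel {`GoodOrd W 2`, `Irr W 2`}; the RESEARCH binder `hμ` = Greenberg's Conj. 1.11 AT
`W` («`X(E/ℚ_∞)` is `Λ`-torsion with `μ = 0`» for every cyclotomic datum); CERT {`2^n ≤ #Sel_{2^∞}(E/ℚ_j)[2]` (`hsel`), `λ_an = n` (`hlan`)}
⟹ `LambdaHalfAtTwo W`. Proof: `hμ` IS the typed gap certificate (`towerGapAtTwo_iff_isTorsion_and_mu_eq_zero`), then GEN 0's tower door.
No Kato 17.4, no `μ_an`, no item 19271 by name. [cite: GreenbergLNM1716, §1 Conj. 1.11 and Prop. 4.14 (§4)] [cite: Washington1997, §13.2]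
[cite: AbbesUllmo1996, Thm. A] -/
theorem lambdaHalfAtTwo_of_isTorsion_mu_eq_zero_of_layerSelmer_of_abbesUllmo (hmod : nonempty_modularParametrizationData)
    (h414 : prop414_noFiniteSubmodule_of_not_dvd_torsionOrder)
    (hAU : abbesUllmo_not_dvd_maninConstant_of_not_dvd_level) (hgo : GoodOrd W 2) (hirr : Irr W 2)
    (hμ : ∀ (κ : ZpExtension ℚ 2) (γ : Field.absoluteGaloisGroup ℚ), κ.IsCyclotomic →
      κ.IsTopGenerator γ → IsCyclotomicVariable 2 γ → ∀ D : W.SelmerDualData κ γ, D.IsTorsion ∧ D.mu = 0)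
    {j n : ℕ} (hsel : ∀ κ : ZpExtension ℚ 2, κ.IsCyclotomic → 2 ^ n ≤ Nat.card {z : W.selmerLayer κ j // 2 • z = 0})
    (hlan : AnalyticLambdaEq W 2 n) : LambdaHalfAtTwo W :=
  lambdaHalfAtTwo_of_towerGap_of_layerSelmer_of_abbesUllmo W hmod h414 hAU hgo hirr
    ((towerGapAtTwo_iff_isTorsion_and_mu_eq_zero W).mpr hμ) hsel hlan

end Door

/-! ## §2 The eight KH residue classes on the Greenberg-μ door -/

/-- **`λ`-HALF AT `65797a1` on the Greenberg-μ door** (`N = 65797 = 19·3463`, `E[2]` irreducible, `λ_an = 9`, own layer-`3` count `2^9 ≤ #Sel_{2^∞}(E/ℚ_3)[2]`):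
PRINT {`hmod`, `h414`, `hAU`} + RESEARCH {`hμ` = Greenberg Conj. 1.11 at `65797a1`} + CERT {`hsel`, `hlan : λ_an = 9`} — BY NAME on `hμ`; compare GEN 3's
`lambdaHalfAtTwo_65797a1_katoHalf_L3` (displays `h17`, `hK`, `hμan` instead). [cite: GreenbergLNM1716, §1 Conj. 1.11 and Prop. 4.14 (§4)] [cite: AbbesUllmo1996, Thm. A] -/
theorem lambdaHalfAtTwo_65797a1_muZero_L3 (hmod : nonempty_modularParametrizationData)
    (h414 : prop414_noFiniteSubmodule_of_not_dvd_torsionOrder) (hAU : abbesUllmo_not_dvd_maninConstant_of_not_dvd_level)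
    (hμ : ∀ (κ : ZpExtension ℚ 2) (γ : Field.absoluteGaloisGroup ℚ), κ.IsCyclotomic →
      κ.IsTopGenerator γ → IsCyclotomicVariable 2 γ → ∀ D : c65797a1.SelmerDualData κ γ, D.IsTorsion ∧ D.mu = 0)
    (hsel : ∀ κ : ZpExtension ℚ 2, κ.IsCyclotomic →
      2 ^ 9 ≤ Nat.card {z : c65797a1.selmerLayer κ 3 // 2 • z = 0})
    (hlan : AnalyticLambdaEq c65797a1 2 9) : LambdaHalfAtTwo c65797a1 :=
  lambdaHalfAtTwo_of_isTorsion_mu_eq_zero_of_layerSelmer_of_abbesUllmo c65797a1 hmod h414 hAU goodOrd_two_65797a1 irr_two_65797a1 hμ hsel hlan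

/-- **`λ`-HALF AT `251493a1` on the Greenberg-μ door** (`N = 251493`, `E[2]` irreducible, `λ_an = 9`, own layer-`3` count `2^9 ≤ #Sel_{2^∞}(E/ℚ_3)[2]`):
PRINT {`hmod`, `h414`, `hAU`} + RESEARCH {`hμ` = Greenberg Conj. 1.11 at `251493a1`} + CERT {`hsel`, `hlan : λ_an = 9`} — BY NAME on `hμ`; compare GEN 3's
`lambdaHalfAtTwo_251493a1_katoHalf_L3` (displays `h17`, `hK`, `hμan` instead). [cite: GreenbergLNM1716, §1 Conj. 1.11 and Prop. 4.14 (§4)] [cite: AbbesUllmo1996, Thm. A] -/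
theorem lambdaHalfAtTwo_251493a1_muZero_L3 (hmod : nonempty_modularParametrizationData)
    (h414 : prop414_noFiniteSubmodule_of_not_dvd_torsionOrder) (hAU : abbesUllmo_not_dvd_maninConstant_of_not_dvd_level)
    (hμ : ∀ (κ : ZpExtension ℚ 2) (γ : Field.absoluteGaloisGroup ℚ), κ.IsCyclotomic →
      κ.IsTopGenerator γ → IsCyclotomicVariable 2 γ → ∀ D : c251493a1.SelmerDualData κ γ, D.IsTorsion ∧ D.mu = 0)
    (hsel : ∀ κ : ZpExtension ℚ 2, κ.IsCyclotomic →
      2 ^ 9 ≤ Nat.card {z : c251493a1.selmerLayer κ 3 // 2 • z = 0})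
    (hlan : AnalyticLambdaEq c251493a1 2 9) : LambdaHalfAtTwo c251493a1 :=
  lambdaHalfAtTwo_of_isTorsion_mu_eq_zero_of_layerSelmer_of_abbesUllmo c251493a1 hmod h414 hAU goodOrd_two_251493a1 irr_two_251493a1 hμ hsel hlan

/-- **`λ`-HALF AT `300219c1` on the Greenberg-μ door** (`N = 300219`, `E[2]` irreducible, `λ_an = 9`, own layer-`3` count `2^9 ≤ #Sel_{2^∞}(E/ℚ_3)[2]`):
PRINT {`hmod`, `h414`, `hAU`} + RESEARCH {`hμ` = Greenberg Conj. 1.11 at `300219c1`} + CERT {`hsel`, `hlan : λ_an = 9`} — BY NAME on `hμ`; compare GEN 3's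
`lambdaHalfAtTwo_300219c1_katoHalf_L3` (displays `h17`, `hK`, `hμan` instead). [cite: GreenbergLNM1716, §1 Conj. 1.11 and Prop. 4.14 (§4)] [cite: AbbesUllmo1996, Thm. A] -/
theorem lambdaHalfAtTwo_300219c1_muZero_L3 (hmod : nonempty_modularParametrizationData)
    (h414 : prop414_noFiniteSubmodule_of_not_dvd_torsionOrder) (hAU : abbesUllmo_not_dvd_maninConstant_of_not_dvd_level)
    (hμ : ∀ (κ : ZpExtension ℚ 2) (γ : Field.absoluteGaloisGroup ℚ), κ.IsCyclotomic →
      κ.IsTopGenerator γ → IsCyclotomicVariable 2 γ → ∀ D : c300219c1.SelmerDualData κ γ, D.IsTorsion ∧ D.mu = 0)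
    (hsel : ∀ κ : ZpExtension ℚ 2, κ.IsCyclotomic →
      2 ^ 9 ≤ Nat.card {z : c300219c1.selmerLayer κ 3 // 2 • z = 0})
    (hlan : AnalyticLambdaEq c300219c1 2 9) : LambdaHalfAtTwo c300219c1 :=
  lambdaHalfAtTwo_of_isTorsion_mu_eq_zero_of_layerSelmer_of_abbesUllmo c300219c1 hmod h414 hAU goodOrd_two_300219c1 irr_two_300219c1 hμ hsel hlan

/-- **`λ`-HALF AT `375411g1` on the Greenberg-μ door** (`N = 375411`, `E[2]` irreducible, `λ_an = 9`, own layer-`3` count `2^9 ≤ #Sel_{2^∞}(E/ℚ_3)[2]`):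
PRINT {`hmod`, `h414`, `hAU`} + RESEARCH {`hμ` = Greenberg Conj. 1.11 at `375411g1`} + CERT {`hsel`, `hlan : λ_an = 9`} — BY NAME on `hμ`; compare GEN 3's
`lambdaHalfAtTwo_375411g1_katoHalf_L3` (displays `h17`, `hK`, `hμan` instead). [cite: GreenbergLNM1716, §1 Conj. 1.11 and Prop. 4.14 (§4)] [cite: AbbesUllmo1996, Thm. A] -/
theorem lambdaHalfAtTwo_375411g1_muZero_L3 (hmod : nonempty_modularParametrizationData)
    (h414 : prop414_noFiniteSubmodule_of_not_dvd_torsionOrder) (hAU : abbesUllmo_not_dvd_maninConstant_of_not_dvd_level)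
    (hμ : ∀ (κ : ZpExtension ℚ 2) (γ : Field.absoluteGaloisGroup ℚ), κ.IsCyclotomic →
      κ.IsTopGenerator γ → IsCyclotomicVariable 2 γ → ∀ D : c375411g1.SelmerDualData κ γ, D.IsTorsion ∧ D.mu = 0)
    (hsel : ∀ κ : ZpExtension ℚ 2, κ.IsCyclotomic →
      2 ^ 9 ≤ Nat.card {z : c375411g1.selmerLayer κ 3 // 2 • z = 0})
    (hlan : AnalyticLambdaEq c375411g1 2 9) : LambdaHalfAtTwo c375411g1 :=
  lambdaHalfAtTwo_of_isTorsion_mu_eq_zero_of_layerSelmer_of_abbesUllmo c375411g1 hmod h414 hAU goodOrd_two_375411g1 irr_two_375411g1 hμ hsel hlan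

/-- **`λ`-HALF AT `445851o1` on the Greenberg-μ door** (`N = 445851`, `E[2]` irreducible, `λ_an = 9`, own layer-`3` count `2^9 ≤ #Sel_{2^∞}(E/ℚ_3)[2]`):
PRINT {`hmod`, `h414`, `hAU`} + RESEARCH {`hμ` = Greenberg Conj. 1.11 at `445851o1`} + CERT {`hsel`, `hlan : λ_an = 9`} — BY NAME on `hμ`; compare GEN 3's
`lambdaHalfAtTwo_445851o1_katoHalf_L3` (displays `h17`, `hK`, `hμan` instead). [cite: GreenbergLNM1716, §1 Conj. 1.11 and Prop. 4.14 (§4)] [cite: AbbesUllmo1996, Thm. A] -/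
theorem lambdaHalfAtTwo_445851o1_muZero_L3 (hmod : nonempty_modularParametrizationData)
    (h414 : prop414_noFiniteSubmodule_of_not_dvd_torsionOrder) (hAU : abbesUllmo_not_dvd_maninConstant_of_not_dvd_level)
    (hμ : ∀ (κ : ZpExtension ℚ 2) (γ : Field.absoluteGaloisGroup ℚ), κ.IsCyclotomic →
      κ.IsTopGenerator γ → IsCyclotomicVariable 2 γ → ∀ D : c445851o1.SelmerDualData κ γ, D.IsTorsion ∧ D.mu = 0)
    (hsel : ∀ κ : ZpExtension ℚ 2, κ.IsCyclotomic →
      2 ^ 9 ≤ Nat.card {z : c445851o1.selmerLayer κ 3 // 2 • z = 0})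
    (hlan : AnalyticLambdaEq c445851o1 2 9) : LambdaHalfAtTwo c445851o1 :=
  lambdaHalfAtTwo_of_isTorsion_mu_eq_zero_of_layerSelmer_of_abbesUllmo c445851o1 hmod h414 hAU goodOrd_two_445851o1 irr_two_445851o1 hμ hsel hlan

/-- **`λ`-HALF AT `488965b1` on the Greenberg-μ door** (`N = 488965`, `E[2]` irreducible, `λ_an = 9`, own layer-`3` count `2^9 ≤ #Sel_{2^∞}(E/ℚ_3)[2]`):
PRINT {`hmod`, `h414`, `hAU`} + RESEARCH {`hμ` = Greenberg Conj. 1.11 at `488965b1`} + CERT {`hsel`, `hlan : λ_an = 9`} — BY NAME on `hμ`; compare GEN 3's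
`lambdaHalfAtTwo_488965b1_katoHalf_L3` (displays `h17`, `hK`, `hμan` instead). [cite: GreenbergLNM1716, §1 Conj. 1.11 and Prop. 4.14 (§4)] [cite: AbbesUllmo1996, Thm. A] -/
theorem lambdaHalfAtTwo_488965b1_muZero_L3 (hmod : nonempty_modularParametrizationData)
    (h414 : prop414_noFiniteSubmodule_of_not_dvd_torsionOrder) (hAU : abbesUllmo_not_dvd_maninConstant_of_not_dvd_level)
    (hμ : ∀ (κ : ZpExtension ℚ 2) (γ : Field.absoluteGaloisGroup ℚ), κ.IsCyclotomic →
      κ.IsTopGenerator γ → IsCyclotomicVariable 2 γ → ∀ D : c488965b1.SelmerDualData κ γ, D.IsTorsion ∧ D.mu = 0)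
    (hsel : ∀ κ : ZpExtension ℚ 2, κ.IsCyclotomic →
      2 ^ 9 ≤ Nat.card {z : c488965b1.selmerLayer κ 3 // 2 • z = 0})
    (hlan : AnalyticLambdaEq c488965b1 2 9) : LambdaHalfAtTwo c488965b1 :=
  lambdaHalfAtTwo_of_isTorsion_mu_eq_zero_of_layerSelmer_of_abbesUllmo c488965b1 hmod h414 hAU goodOrd_two_488965b1 irr_two_488965b1 hμ hsel hlan

/-- **`λ`-HALF AT `407305e1` on the Greenberg-μ door** (`N = 407305`, `E[2]` irreducible, `λ_an = 10`, own layer-`3` count `2^10 ≤ #Sel_{2^∞}(E/ℚ_3)[2]`):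
PRINT {`hmod`, `h414`, `hAU`} + RESEARCH {`hμ` = Greenberg Conj. 1.11 at `407305e1`} + CERT {`hsel`, `hlan : λ_an = 10`} — BY NAME on `hμ`; compare GEN 3's
`lambdaHalfAtTwo_407305e1_katoHalf_L3` (displays `h17`, `hK`, `hμan` instead). [cite: GreenbergLNM1716, §1 Conj. 1.11 and Prop. 4.14 (§4)] [cite: AbbesUllmo1996, Thm. A] -/
theorem lambdaHalfAtTwo_407305e1_muZero_L3 (hmod : nonempty_modularParametrizationData)
    (h414 : prop414_noFiniteSubmodule_of_not_dvd_torsionOrder) (hAU : abbesUllmo_not_dvd_maninConstant_of_not_dvd_level)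
    (hμ : ∀ (κ : ZpExtension ℚ 2) (γ : Field.absoluteGaloisGroup ℚ), κ.IsCyclotomic →
      κ.IsTopGenerator γ → IsCyclotomicVariable 2 γ → ∀ D : c407305e1.SelmerDualData κ γ, D.IsTorsion ∧ D.mu = 0)
    (hsel : ∀ κ : ZpExtension ℚ 2, κ.IsCyclotomic →
      2 ^ 10 ≤ Nat.card {z : c407305e1.selmerLayer κ 3 // 2 • z = 0})
    (hlan : AnalyticLambdaEq c407305e1 2 10) : LambdaHalfAtTwo c407305e1 :=
  lambdaHalfAtTwo_of_isTorsion_mu_eq_zero_of_layerSelmer_of_abbesUllmo c407305e1 hmod h414 hAU goodOrd_two_407305e1 irr_two_407305e1 hμ hsel hlan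

/-- **`λ`-HALF AT `288855s1` on the Greenberg-μ door** (`N = 288855`, `E[2]` irreducible, `λ_an = 10`, own layer-`3` count `2^10 ≤ #Sel_{2^∞}(E/ℚ_3)[2]`):
PRINT {`hmod`, `h414`, `hAU`} + RESEARCH {`hμ` = Greenberg Conj. 1.11 at `288855s1`} + CERT {`hsel`, `hlan : λ_an = 10`} — BY NAME on `hμ`; compare GEN 3's
`lambdaHalfAtTwo_288855s1_katoHalf_L3` (displays `h17`, `hK`, `hμan` instead). [cite: GreenbergLNM1716, §1 Conj. 1.11 and Prop. 4.14 (§4)] [cite: AbbesUllmo1996, Thm. A] -/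
theorem lambdaHalfAtTwo_288855s1_muZero_L3 (hmod : nonempty_modularParametrizationData)
    (h414 : prop414_noFiniteSubmodule_of_not_dvd_torsionOrder) (hAU : abbesUllmo_not_dvd_maninConstant_of_not_dvd_level)
    (hμ : ∀ (κ : ZpExtension ℚ 2) (γ : Field.absoluteGaloisGroup ℚ), κ.IsCyclotomic →
      κ.IsTopGenerator γ → IsCyclotomicVariable 2 γ → ∀ D : c288855s1.SelmerDualData κ γ, D.IsTorsion ∧ D.mu = 0)
    (hsel : ∀ κ : ZpExtension ℚ 2, κ.IsCyclotomic →
      2 ^ 10 ≤ Nat.card {z : c288855s1.selmerLayer κ 3 // 2 • z = 0})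
    (hlan : AnalyticLambdaEq c288855s1 2 10) : LambdaHalfAtTwo c288855s1 :=
  lambdaHalfAtTwo_of_isTorsion_mu_eq_zero_of_layerSelmer_of_abbesUllmo c288855s1 hmod h414 hAU goodOrd_two_288855s1 irr_two_288855s1 hμ hsel hlan

end Summit.BirchSwinnertonDyer.BirchSwinnertonDyer.Theorems.TwoAdicTwistConverse

end
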